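import Literature.AlgebraicGeometry.GroupSchemes.CartierDualExact
import Literature.AlgebraicGeometry.GroupSchemes.CartierDualBaseChangeNatural
import Literature.AlgebraicGeometry.GroupSchemes.CartierDualAnnihilatorFlat
import Literature.AlgebraicGeometry.GroupSchemes.UnitComponentRank
import Literature.AlgebraicGeometry.GroupSchemes.KernelLocusFiniteFlat
import Literature.AlgebraicGeometry.Morphisms.FlatOfFlatFibres
import Mathlib.RingTheory.Artinian.Ring
import Mathlib.AlgebraicGeometry.PullbackCarrier
import Mathlib.AlgebraicGeometry.ResidueField
import HarnessLib

/-!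
# The Cartier–Tate quotient over a noetherian LOCAL base (e.g. an ARTINIAN local ring): `j^D` is faithfully flat, `Γ(H^⊥)` is FREE,
# and `G → G⧸H = (H^⊥)^D` is flat and surjective (Tate 1997 (3.7)–(3.8); EGA IV₃ 11.3.10)

Layer `Literature/AlgebraicGeometry/GroupSchemes`, namespace `Literature.AlgebraicGeometry.GroupSchemes.AffineGroupScheme` (continues ★ `CartierDualExact`
— the FIELD case: `j^D` faithfully flat for a closed immersion `j` —, ★ `CartierDualBaseChangeNatural` — `(j^D)_{R′} ≫ φ_H = φ_G ≫ (j_{R′})^D` —, ★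
`CartierDualQuotient` — `quot j := (H^⊥)^D`, `quotProj j = ε_G⁻¹ ≫ (ι_{H^⊥})^D` under `[Module.Free R (Alg (annihilator j))]` —, ★ `CartierDualAnnihilatorFlat` — `Γ(H^⊥)` free
over local DOMAINS by fibre-rank constancy — and the tree's critère de platitude par fibres ★ `Morphisms/FlatOfFlatFibres`).  THEOREMS ONLY (no definition, no
instance, no notation, no named fact, no `sorry`).  Cell `hodgecm-mathlib` (D-0151), programme P6b «BT groups & Serre–Tate», wave A seat A3 (E2b-S1 «Cartier–Tate
quotient over an Artinian local base», desk F0P6b-plan (g13) `DEALS-waveA.v1` fd74acb0e1fc18e3; director g34 s1741 (a)); prover LA2-p03 (g9), 2026-09-03.  It pays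
the stub `stub_E2bCT_freeAnnihilator` (CT1) of the HOME sub-line cand `F0_P6b_Sigma2ImageQuot.ed1.cand.v1` dfae2a4261ab78b9 BY TYPE (§2, token for token) and the
flat ∕ surjective half of `stub_E2bCT_quotProjFaithfullyFlat` (CT2, §3; the kernel clause is the sequel ★ `CartierDualQuotientArtinianKernel`).  Count-neutral
Mathlib-side capital: HC_CM is proved only modulo the printed citations until rung 0 closes; nothing here bears on it.

THE PRINT ([Tate1997FiniteFlatGroupSchemes] (3.7): for a finite flat closed subgroup `H ⊂ G` of a finite flat commutative group scheme over ANY base, `G⧸H`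
exists, is finite flat of order `[G : H]`, `G → G⧸H` is faithfully flat with kernel `H`, and `(G⧸H)^D = H^⊥`; §(3.8) p. 146: `G ↦ G^D` is exact; [EGAIV3] Thm.
11.3.10 ∕ [StacksProject] Tag 039E: a morphism `f : X → Y` of `S`-schemes with `X` flat of finite presentation and `Y` of finite type over `S` is flat as soon
as all its fibres are; [Waterhouse1979] §14.1: over a field a homomorphism with `Γ` injective is faithfully flat).  For a homomorphism `j : H ⟶ G` of finite free
commutative affine group objects of `SchemeOver R` whose underlying morphism is a closed immersion:

* §0 `surjective_of_forall_surjective_pullback_Spec_field` — a morphism over `S` all of whose base changes to spectra of fields are surjective is surjective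
  (points of `Y` over `s` lie on the fibre `Y ×_S Spec κ(s)`; Mathlib `Scheme.Pullback.range_fst`).
* §1 (`R` noetherian) `locallyOfFinitePresentation_cartierDual_hom`; **`flat_and_surjective_pullback_map_cartierDualMap`** — every base change `(j^D)_K` to a field
  `K` is flat and surjective (`(j^D)_K = φ_G ≫ (j_K)^D ≫ φ_H⁻¹` by the ★ naturality, `j_K` is again a closed immersion, ★ field case); **`flat_and_surjective_cartierDualMap_left`**
  (fibre criterion + §0): `j^D : G^D → H^D` IS FAITHFULLY FLAT; `flat_annihilator_hom` (`H^⊥ = ker (j^D)` is the base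
  change of `j^D` along the unit section, ★ `isPullback_kerι_left`).
* §2 (`R` noetherian LOCAL) **`flat_hom_and_free_alg_annihilator : Flat (annihilator j).hom ∧ Module.Free R (Alg (annihilator j))`** (finite + flat over local ⇒ free, ★ `free_alg_of_flat`)
  and its Artinian-local specialisation **`free_alg_annihilator_of_isArtinianRing`** = the TYPE of the P6b stub CT1 (Akizuki: Artinian ⇒ noetherian).
* §3 (`R` noetherian, `Γ(H^⊥)` free) **`flat_quotProj_left_of_isNoetherianRing`**, **`surjective_quotProj_left_of_free`** — `G → G⧸H` is flat and surjective
  (`quotProj = ε_G⁻¹ ≫ (ι_{H^⊥})^D`, §1 at the closed immersion `ι_{H^⊥} : H^⊥ ↪ G^D`).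

NOT here: the kernel clause `ker (G → G⧸H) = H` (sequel ★ `CartierDualQuotientArtinianKernel`: the double annihilator `(H^⊥)^⊥ = H` over a local base by
rank); non-local bases (there `H^⊥` is finite LOCALLY free by the same fibrewise flatness).

## References
* [Tate1997FiniteFlatGroupSchemes] J. Tate, *Finite flat group schemes*, in: Modular Forms and Fermat's Last Theorem (1997), (3.7), §(3.8) pp. 145–146.
* [EGAIV3] A. Grothendieck, J. Dieudonné, *ÉGA* IV₃, Publ. Math. IHÉS 28 (1966), Thm. 11.3.10.
* [StacksProject] The Stacks Project, Tags 039D–039E (critère de platitude par fibres), 01S1 (surjective morphisms), 00NZ (Akizuki).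
* [Waterhouse1979] W. C. Waterhouse, *Introduction to Affine Group Schemes*, GTM 66 (1979), §14.1 Theorem.
-/

set_option autoImplicit false

-- Mathlib's `Over`/`Scheme` APIs are stated across semireducible wrappers (as in the ★ `GroupSchemes/*` files).
set_option backward.isDefEq.respectTransparency false

universe u

open CategoryTheory CategoryTheory.Limits AlgebraicGeometry MonoidalCategory CartesianMonoidalCategory TensorProduct WithConv

noncomputable section

namespace Literature.AlgebraicGeometry.GroupSchemes

namespace AffineGroupScheme

open scoped MonObj CategoryTheory.Obj

open Literature.AlgebraicGeometry.Motives Literature.NumberTheory.DiophantineGeometry Literature.RingTheory.HopfAlgebra GroupSchemeKernel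
open Literature.AlgebraicGeometry.Morphisms

/-! ## §1 Over a noetherian base: `j^D : G^D → H^D` is flat for a closed immersion `j` (fibre criterion + the field case) -/

/-! ## §0 Surjectivity is detected on the base changes to fields -/

section SurjectiveFibres

/-- **A morphism over `S` all of whose base changes to spectra of fields are surjective is surjective**: a point `y` of `Y` over `s ∈ S`
lies on the fibre `Y ×_S Spec κ(s)` (Mathlib `Scheme.Pullback.range_fst`, `Scheme.range_fromSpecResidueField`), where it is hit by a point of
`X ×_S Spec κ(s)`, whose image in `X` maps to `y` (the base-change square, ★ `isPullback_pullback_map_left`). [cite: EGAIV3, Thm. 11.3.10]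
[cite: StacksProject, Tag 01S1] -/
theorem surjective_of_forall_surjective_pullback_Spec_field {S : Scheme.{u}} {X Y : Over S} (f : X ⟶ Y)
    (h : ∀ (K : Type u) [Field K] (t : Spec (.of K) ⟶ S), Surjective ((Over.pullback t).map f).left) :
    Surjective f.left := by
  refine ⟨fun y => ?_⟩
  set s : S := Y.hom.base y with hs
  set t := S.fromSpecResidueField s with ht
  have hy : y ∈ Set.range (pullback.fst Y.hom t).base := by
    rw [Scheme.Pullback.range_fst]
    show Y.hom.base y ∈ Set.range t.base
    rw [ht, Scheme.range_fromSpecResidueField]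
    exact Set.mem_singleton _
  obtain ⟨y', hy'⟩ := hy
  obtain ⟨x', hx'⟩ := (h _ t).surj y'
  refine ⟨(pullback.fst X.hom t).base x', ?_⟩
  have hw := (isPullback_pullback_map_left t f).w
  rw [← Scheme.Hom.comp_apply, hw, Scheme.Hom.comp_apply]
  exact (congrArg (fun z => (pullback.fst Y.hom t).base z) hx').trans hy'

end SurjectiveFibres

section FinitePresentation

variable {R : Type u} [CommRing R] [IsNoetherianRing R] (G : SchemeOver R)
  [GrpObj G] [IsCommMonObj G] [IsAffine G.left] [Module.Free R (Alg G)] [Module.Finite R (Alg G)]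

/-- Over a noetherian ring, the structure morphism `G^D → Spec R` of the Cartier dual of a finite free `G` is locally of finite presentation
(`Γ(G^D) = Γ(G)^*` is a finite `R`-module, hence an `R`-algebra of finite type, hence of finite presentation over the noetherian `R`).
[cite: EGAIV3, Thm. 11.3.10] -/
theorem locallyOfFinitePresentation_cartierDual_hom : LocallyOfFinitePresentation (cartierDual G).hom := by
  rw [cartierDual_hom]
  have hft : Algebra.FiniteType R (DualAlg G) := inferInstance
  have hfp : Algebra.FinitePresentation R (DualAlg G) := (Algebra.FinitePresentation.of_finiteType).mp hft
  have h : (algebraMap R (DualAlg G)).FinitePresentation := by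
    rwa [RingHom.finitePresentation_algebraMap]
  exact (HasRingHomProperty.Spec_iff (P := @LocallyOfFinitePresentation)).mpr h

end FinitePresentation

section Noetherian

variable {R : Type u} [CommRing R] [IsNoetherianRing R] {H G : SchemeOver R}
  [GrpObj H] [IsCommMonObj H] [IsAffine H.left] [Module.Free R (Alg H)] [Module.Finite R (Alg H)]
  [GrpObj G] [IsCommMonObj G] [IsAffine G.left] [Module.Free R (Alg G)] [Module.Finite R (Alg G)]
  (j : H ⟶ G) [IsMonHom j]

omit [IsNoetherianRing R] in
/-- For every base change to a FIELD `K`, `(j^D)_K` is flat and surjective: by the naturality of the base-change isomorphism of the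
Cartier dual (★ `pullback_map_cartierDualMap_comp_cartierDualBaseChangeIso_hom`) `(j^D)_K = φ_G ≫ (j_K)^D ≫ φ_H⁻¹`, and `j_K` is again a closed
immersion of finite commutative group schemes over the field `K`, whose dual is faithfully flat (★ `flat_∕surjective_cartierDualMap_left_of_isClosedImmersion`,
[Waterhouse1979] §14.1). [cite: Tate1997FiniteFlatGroupSchemes, §(3.8) p. 146] [cite: Waterhouse1979, §14.1 Theorem] -/
theorem flat_and_surjective_pullback_map_cartierDualMap [IsClosedImmersion j.left] (K : Type u) [Field K]
    (t : Spec (.of K) ⟶ Spec (.of R)) :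
    Flat ((Over.pullback t).map (cartierDualMap j)).left ∧ Surjective ((Over.pullback t).map (cartierDualMap j)).left := by
  obtain ⟨φ, rfl⟩ : ∃ φ, t = Spec.map φ := ⟨Spec.preimage t, (Spec.map_preimage t).symm⟩
  letI : Algebra R K := φ.hom.toAlgebra
  change Flat ((Over.pullback (Spec.map (CommRingCat.ofHom (algebraMap R K)))).map (cartierDualMap j)).left ∧
    Surjective ((Over.pullback (Spec.map (CommRingCat.ofHom (algebraMap R K)))).map (cartierDualMap j)).left
  -- the base-changed objects are affine, commutative, with finite free algebras over the field `K`
  haveI := isAffine_pullback_obj_left K H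
  haveI := isAffine_pullback_obj_left K G
  haveI := isAffine_pullback_obj_left K (cartierDual H)
  haveI := isAffine_pullback_obj_left K (cartierDual G)
  haveI : IsCommMonObj ((Over.pullback (Spec.map (CommRingCat.ofHom (algebraMap R K)))).obj H) := inferInstance
  haveI : IsCommMonObj ((Over.pullback (Spec.map (CommRingCat.ofHom (algebraMap R K)))).obj G) := inferInstance
  haveI := finite_alg_baseChange K H
  haveI := finite_alg_baseChange K G
  haveI := free_alg_baseChange K H
  haveI := free_alg_baseChange K G
  haveI : IsClosedImmersion ((Over.pullback (Spec.map (CommRingCat.ofHom (algebraMap R K)))).map j).left :=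
    of_pullback_map_left _ (P := @IsClosedImmersion) j inferInstance
  -- `(j^D)_K = φ_G ≫ (j_K)^D ≫ φ_H⁻¹`
  have hnat := pullback_map_cartierDualMap_comp_cartierDualBaseChangeIso_hom K j
  have heq : (Over.pullback (Spec.map (CommRingCat.ofHom (algebraMap R K)))).map (cartierDualMap j) =
      (cartierDualBaseChangeIso K G).hom ≫
        cartierDualMap ((Over.pullback (Spec.map (CommRingCat.ofHom (algebraMap R K)))).map j) ≫ (cartierDualBaseChangeIso K H).inv := by
    rw [← Category.assoc, ← hnat, Category.assoc, Iso.hom_inv_id, Category.comp_id]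
  haveI : Flat (cartierDualMap ((Over.pullback (Spec.map (CommRingCat.ofHom (algebraMap R K)))).map j)).left :=
    flat_cartierDualMap_left_of_isClosedImmersion _
  haveI : Surjective (cartierDualMap ((Over.pullback (Spec.map (CommRingCat.ofHom (algebraMap R K)))).map j)).left :=
    surjective_cartierDualMap_left_of_isClosedImmersion _
  rw [heq, Over.comp_left, Over.comp_left]
  exact ⟨inferInstance, inferInstance⟩

/-- **`j^D : G^D → H^D` IS FAITHFULLY FLAT (flat AND surjective) over a noetherian base** for a homomorphism `j : H ⟶ G` of finite free commutative
affine group objects whose underlying morphism is a closed immersion: by the «critère de platitude par fibres» ([EGAIV3] Thm. 11.3.10 ∕ [StacksProject]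
Tag 039E, ★ `Morphisms.flat_of_forall_flat_pullback_Spec_field`: `G^D` is flat and of finite presentation over `R`) and §0, it suffices that every base
change `(j^D)_K` to a field `K` be flat and surjective (`flat_and_surjective_pullback_map_cartierDualMap`).  Stated as ONE conjunction («faithfully flat»);
the field case is ★ `flat_∕surjective_cartierDualMap_left_of_isClosedImmersion`. [cite: Tate1997FiniteFlatGroupSchemes, §(3.8) p. 146] [cite: EGAIV3, Thm. 11.3.10] -/
theorem flat_and_surjective_cartierDualMap_left [IsClosedImmersion j.left] :
    Flat (cartierDualMap j).left ∧ Surjective (cartierDualMap j).left := by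
  haveI := locallyOfFinitePresentation_cartierDual_hom G
  exact ⟨flat_of_forall_flat_pullback_Spec_field (S := Spec (.of R)) (cartierDualMap j)
      fun K _ t => (flat_and_surjective_pullback_map_cartierDualMap j K t).1,
    surjective_of_forall_surjective_pullback_Spec_field (cartierDualMap j)
      fun K _ t => (flat_and_surjective_pullback_map_cartierDualMap j K t).2⟩

end Noetherian

section AnyBase

variable {R : Type u} [CommRing R] {H G : SchemeOver R}
  [GrpObj H] [IsCommMonObj H] [IsAffine H.left] [Module.Free R (Alg H)] [Module.Finite R (Alg H)]
  [GrpObj G] [IsCommMonObj G] [IsAffine G.left] [Module.Free R (Alg G)] [Module.Finite R (Alg G)]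
  (j : H ⟶ G) [IsMonHom j]

omit [Module.Free R (Alg G)] [Module.Finite R (Alg G)] in
/-- **`H^⊥ → Spec R` IS FLAT** whenever `j^D` is flat: `H^⊥ = ker (j^D)` is the base change of `j^D` along the unit section of `H^D`
(★ `GroupSchemeKernel.isPullback_kerι_left`; flatness is stable under base change). [cite: Tate1997FiniteFlatGroupSchemes, §(3.8) p. 146] -/
theorem flat_annihilator_hom [Flat (cartierDualMap j).left] : Flat (annihilator j).hom := by
  have h1 : Flat (pullback.snd (cartierDualMap j) η[cartierDual H]).left :=
    MorphismProperty.of_isPullback (isPullback_kerι_left (cartierDualMap j)) ‹Flat (cartierDualMap j).left›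
  have h2 : Flat (𝟙_ (SchemeOver R)).hom := by
    change Flat (𝟙 _)
    infer_instance
  rw [annihilator_def, show (ker (cartierDualMap j)).hom =
    (pullback.snd (cartierDualMap j) η[cartierDual H]).left ≫ (𝟙_ (SchemeOver R)).hom from (Over.w _).symm]
  infer_instance

end AnyBase

/-! ## §2 Over a noetherian LOCAL base (e.g. Artinian local): `Γ(H^⊥)` is FREE -/

section Local

variable {R : Type u} [CommRing R] [IsNoetherianRing R] [IsLocalRing R] {H G : SchemeOver R}
  [GrpObj H] [IsCommMonObj H] [IsAffine H.left] [Module.Free R (Alg H)] [Module.Finite R (Alg H)]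
  [GrpObj G] [IsCommMonObj G] [IsAffine G.left] [Module.Free R (Alg G)] [Module.Finite R (Alg G)]
  (j : H ⟶ G) [IsMonHom j] [IsClosedImmersion j.left]

/-- **`H^⊥` IS FLAT OVER `Spec R` AND `Γ(H^⊥)` IS FREE, OVER A NOETHERIAN LOCAL RING** (in particular over an ARTINIAN local ring) —
[Tate1997FiniteFlatGroupSchemes] (3.7)∕§(3.8): `H^⊥ = ker (j^D)` is finite (★ `isFinite_ker_hom`) and flat (§1) over the local `R`, hence `Γ(H^⊥)` is a finite
flat, i.e. free, `R`-module (★ `free_alg_of_flat`, Mathlib `Module.free_of_flat_of_isLocalRing`).  Stated as ONE conjunction (flatness of the structure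
morphism + freeness of the algebra); the local-DOMAIN case of the second clause is ★ `free_alg_annihilator`.
[cite: Tate1997FiniteFlatGroupSchemes, §(3.8) p. 146] [cite: EGAIV3, Thm. 11.3.10] -/
theorem flat_hom_and_free_alg_annihilator : Flat (annihilator j).hom ∧ Module.Free R (Alg (annihilator j)) := by
  haveI := (flat_and_surjective_cartierDualMap_left j).1
  haveI := flat_annihilator_hom j
  haveI : IsFinite (annihilator j).hom := by
    rw [annihilator_def]
    exact isFinite_ker_hom (cartierDualMap j)
  exact ⟨inferInstance, free_alg_of_flat (annihilator j)⟩

/-- **CT1 — `Γ(H^⊥)` IS FREE OVER AN ARTINIAN LOCAL RING** (the statement of the P6b line's stub `stub_E2bCT_freeAnnihilator`, token for token):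
an Artinian ring is noetherian (Akizuki), so `flat_hom_and_free_alg_annihilator` applies. [cite: Tate1997FiniteFlatGroupSchemes, §(3.8) p. 146]
[cite: EGAIV3, Thm. 11.3.10] -/
theorem free_alg_annihilator_of_isArtinianRing :
    ∀ (A : Type) [CommRing A] [IsArtinianRing A] [IsLocalRing A] (H G : SchemeOver A)
      [GrpObj H] [IsCommMonObj H] [IsAffine H.left] [Module.Free A (Alg H)] [Module.Finite A (Alg H)]
      [GrpObj G] [IsCommMonObj G] [IsAffine G.left] [Module.Free A (Alg G)] [Module.Finite A (Alg G)]
      (j : H ⟶ G) [IsMonHom j] [IsClosedImmersion j.left],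
      Module.Free A (Alg (annihilator j)) := by
  intro A _ _ _ H G _ _ _ _ _ _ _ _ _ _ j _ _
  exact (flat_hom_and_free_alg_annihilator j).2

end Local

/-! ## §3 Over a noetherian LOCAL base: the Cartier–Tate projection `G → G⧸H = (H^⊥)^D` is flat and surjective -/

section QuotProj

variable {R : Type u} [CommRing R] [IsNoetherianRing R] {H G : SchemeOver R}
  [GrpObj H] [IsCommMonObj H] [IsAffine H.left] [Module.Free R (Alg H)] [Module.Finite R (Alg H)]
  [GrpObj G] [IsCommMonObj G] [IsAffine G.left] [Module.Free R (Alg G)] [Module.Finite R (Alg G)]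
  (j : H ⟶ G) [IsMonHom j] [Module.Free R (Alg (annihilator j))]

/-- **`G → G⧸H` IS FLAT** over a noetherian base once `Γ(H^⊥)` is free (e.g. over an Artinian local base, §2): `quotProj j = ε_G⁻¹ ≫ (ι_{H^⊥})^D`
(★ `quotProj_def`) and `(ι_{H^⊥})^D` is flat by §1 applied to the closed immersion `ι_{H^⊥} : H^⊥ ↪ G^D` (★ `isClosedImmersion_annihilatorι_left`).
Field case: ★ `flat_quotProj_left`. [cite: Tate1997FiniteFlatGroupSchemes, (3.7)] [cite: EGAIV3, Thm. 11.3.10] -/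
theorem flat_quotProj_left_of_isNoetherianRing : Flat (quotProj j).left := by
  haveI := isClosedImmersion_annihilatorι_left j
  haveI := (flat_and_surjective_cartierDualMap_left (annihilatorι j)).1
  rw [quotProj_def, Over.comp_left]
  infer_instance

/-- **`G → G⧸H` IS SURJECTIVE** once `Γ(H^⊥)` is free: `(ι_{H^⊥})^D` is surjective by §1. Field case: ★ `surjective_quotProj_left`.
[cite: Tate1997FiniteFlatGroupSchemes, (3.7)] [cite: Waterhouse1979, §14.1 Theorem] -/
theorem surjective_quotProj_left_of_free : Surjective (quotProj j).left := by
  haveI := isClosedImmersion_annihilatorι_left j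
  haveI := (flat_and_surjective_cartierDualMap_left (annihilatorι j)).2
  rw [quotProj_def, Over.comp_left]
  infer_instance

end QuotProj


end AffineGroupScheme

end Literature.AlgebraicGeometry.GroupSchemes

end
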